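import Summits.QuantumFields.YangMills.Theorems.FluctuationComparisonRegPrIntLS2BetaParityBlockPartition
import Summits.QuantumFields.YangMills.Theorems.FluctuationComparisonRegPrIntLS2BetaDistributedHolonomySU2
import HarnessLib

/-!
# S2β · D-GUARD ∕ (BG∞) — THE GLUE (gap-list item (G8) of UV3-NODE §116.4, BINDER STYLE per desk RULING №127 «(P7-D)»): consistent sections `w_Q` of block gauges
# `g_Q` on the parity blocks give ONE gauge `x ↦ w_{owner x}(x)·g_{owner x}(x)` whose every bond costs at most «local gauge + section step», read in the owner block

Cell `ym3-torus` (YM ladder rung R3 = continuum `SU(2)` Yang–Mills on the three-torus at fixed lattice data — a RUNG: NOT d = 4, NOT infinite volume,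
NOT a mass gap, NOT Clay).  Width seat «width 19» `ym3-torus-px19` (gen 25, ★p1 lineage), FREE px helper on crux `stmt-QuantumFields-20520`
(`FluctuationComparisonRegPrIntL`; registry `Lines/semiclassical_s2beta.lean` UNTOUCHED, 0∕5); `--kind proof --supports stmt-QuantumFields-20520 --as helper`,
count-neutral, DEFINITION-FREE (0 `def`, 0 `instance`, 0 `notation`, 0 `sorry`, default heartbeats).  (BG∞) plan of record UV3-NODE §116; block-data text v1 =
the binders of ✓`…ParityBlockPartition.exists_parityBlocks` (`M len start owner` + laws), one copy for all axes (desk RULING №127 R2, LEAD №51).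

WHY.  Step C of §116.3 produces, on every closed block `Q̄ = {x | ∀ κ, (x_κ − start(Q_κ)).val ≤ len(Q_κ)}`, a section `w_Q` consistent with its neighbours
(`w_Q·g_Q = w_{Q′}·g_{Q′}` on shared sites); the GLOBAL gauge is read in the owner block of each site.  Because every bond `b` lies in the closed block of
`owner(b.src)` (the owner law + the wrap-safe target reading ✓`val_add_one_sub_natCast_le_of`) and the target's own owner block agrees there by consistency, the
gauged bond is `w(x)·[(g_Q•V) b]·w(y)⁻¹` with both `w`'s read in ONE block `Q`, hence within `dist1((g_Q•V) b) + dist1(w_Q(x)·w_Q(y)⁻¹)` of `1`.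

WHAT IS PROVED (sorry-free; any `[GaugeGroup G]`, any `Params`, any level `j`, `N := P.sitesPerDir j`).
* §1 ★ `owner_mem_closedBlock` (the owner law ⟹ `x ∈ Q̄_{owner x}`), ★ `tgt_mem_closedBlock` (and `b.tgt ∈ Q̄_{owner b.src}`, wrap included, given `len < N`).
* §2 ★★★ `dist1_glue_le` — for `g w : (Fin P.d → Fin M) → Site P j → G` consistent on shared closed-block sites:
  `dist1 ((x ↦ w_{owner x} x·g_{owner x} x) • V) b ≤ dist1 ((g_Q • V) b) + dist1 (w_Q b.src·(w_Q b.tgt)⁻¹)`, `Q := owner ∘ b.src`.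
* §3 ★★ `dist1_glue_le_of_bounds` (`≤ δ + η′` from a local-gauge letter `δ` and a section-step letter `η′` on closed blocks), ★★ `norm_logVec_glue_le_of_bounds` (the
  `SU(2)` arc reading `≤ (π∕2)(δ + η′)`, ✓`norm_logVec_le_pi_div_two_mul_dist1`) — the two lines LEAD's final assembly `hBG_of_pieces` consumes.

HONEST SCOPE.  Group bookkeeping over the block-data binders; nothing of Bałaban's renormalisation-group analysis is asserted or proved ([Balaban1985RegularSpaces] Lemma 1
p.79, (1.29) p.81 — local gauges on cubes; [Balaban1985Averaging] (8) p.18 — the gauge action).  (BG∞) ∕ `hsupp⁺` is a CONJECTURE (LEAD §114.3, plan §116, FL-39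
alive) and is NOT proved; (G7)-lattice (the sections) is OPEN; GAP♯∘ (`stub_uniformFibreGapOrbit`, registry UNTOUCHED), the five registered stubs (0∕5), S2β, 20520,
19936, 19200, `YM3TorusSU2` are NOT proved; no registered stub is closed; rung R3 — NOT d = 4, NOT infinite volume, NOT a mass gap, NOT Clay; the Yang–Mills mass
gap is NOT proved.  Axioms standard.

References: T. Bałaban, CMP **98** (1985) 17–51 [Balaban1985Averaging] ((8) p.18); CMP **99** (1985) 75–102 [Balaban1985RegularSpaces] (Lemma 1 p.79, (1.29) p.81).
-/

set_option autoImplicit false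

noncomputable section

namespace Summit.QuantumFields.YangMills.Theorems.FluctuationComparisonRegPrIntLS2BetaSqrtGaugeGlue

open scoped Real
open Literature.MathematicalPhysics.QuantumLattice (su2Quat)
open Literature.MathematicalPhysics.QuantumFieldTheory.Balaban1983to89
open T4CubeChartGnomonic (SU2)
open T4ExpWindowSmallField (logVec)
open Summit.QuantumFields.YangMills.Theorems.FluctuationComparisonRegPrIntLS2BetaParityBlockPartition (val_sub_natCast_le_of val_add_one_sub_natCast_le_of)
open Summit.QuantumFields.YangMills.Theorems.FluctuationComparisonRegPrIntLS2BetaDistributedHolonomySU2 (norm_logVec_le_pi_div_two_mul_dist1)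

variable {P : Params} {j : ℕ} {M : ℕ}

/-! ## §1 Every bond lies in the closed block of its source's owner -/

/-- ★ **THE OWNER'S CLOSED BLOCK CONTAINS THE SITE**: from the owner law `start (owner v) ≤ v.val < start (owner v) + len (owner v)` (block-data text v1),
`(x_κ − start(owner x_κ)).val ≤ len(owner x_κ)` for every axis. [folklore] -/
theorem owner_mem_closedBlock (len start : Fin M → ℕ) (owner : ZMod (P.sitesPerDir j) → Fin M)
    (hown : ∀ v : ZMod (P.sitesPerDir j), start (owner v) ≤ v.val ∧ v.val < start (owner v) + len (owner v))
    (x : Site P j) (κ : Fin P.d) :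
    (x κ - ((start (owner (x κ)) : ℕ) : ZMod (P.sitesPerDir j))).val ≤ len (owner (x κ)) :=
  val_sub_natCast_le_of (x κ) (hown (x κ)).1 (hown (x κ)).2.le

/-- ★ **… AND THE BOND LEAVING IT**: `(b.tgt_κ − start(owner b.src_κ)).val ≤ len(owner b.src_κ)` for every axis (the step axis uses the wrap-safe reading
✓`val_add_one_sub_natCast_le_of`, which needs `len < N`). [folklore] -/
theorem tgt_mem_closedBlock (len start : Fin M → ℕ) (owner : ZMod (P.sitesPerDir j) → Fin M)
    (hown : ∀ v : ZMod (P.sitesPerDir j), start (owner v) ≤ v.val ∧ v.val < start (owner v) + len (owner v))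
    (hlen : ∀ i, len i < P.sitesPerDir j) (b : PBond P j) (κ : Fin P.d) :
    (b.tgt κ - ((start (owner (b.src κ)) : ℕ) : ZMod (P.sitesPerDir j))).val ≤ len (owner (b.src κ)) := by
  show (Function.update b.src b.dir (b.src b.dir + 1) κ - _).val ≤ _
  by_cases hκ : κ = b.dir
  · rw [hκ, Function.update_self]
    exact val_add_one_sub_natCast_le_of (b.src b.dir) (hown (b.src b.dir)).1 (hown (b.src b.dir)).2 (hlen _)
  · rw [Function.update_of_ne hκ]
    exact val_sub_natCast_le_of (b.src κ) (hown (b.src κ)).1 (hown (b.src κ)).2.le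

/-! ## §2 The glue -/

section Glue
variable {G : Type*} [GaugeGroup G]

/-- ★★★ **THE GLUE** ((G8) of UV3-NODE §116.4): for block gauges `g_Q` and sections `w_Q` CONSISTENT on shared closed-block sites, the global gauge
`x ↦ w_{owner x}(x)·g_{owner x}(x)` satisfies, at every bond `b` and with `Q := owner ∘ b.src`,
`dist1 (((x ↦ w_{owner x} x·g_{owner x} x) • V) b) ≤ dist1 ((g_Q • V) b) + dist1 (w_Q b.src·(w_Q b.tgt)⁻¹)`. [cite: Balaban1985RegularSpaces, Lemma 1 p.79; Balaban1985Averaging, (8) p.18] -/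
theorem dist1_glue_le (len start : Fin M → ℕ) (owner : ZMod (P.sitesPerDir j) → Fin M)
    (hown : ∀ v : ZMod (P.sitesPerDir j), start (owner v) ≤ v.val ∧ v.val < start (owner v) + len (owner v))
    (hlen : ∀ i, len i < P.sitesPerDir j)
    (g w : (Fin P.d → Fin M) → Site P j → G)
    (hcons : ∀ (Q Q' : Fin P.d → Fin M) (x : Site P j),
      (∀ κ, (x κ - ((start (Q κ) : ℕ) : ZMod (P.sitesPerDir j))).val ≤ len (Q κ)) →
      (∀ κ, (x κ - ((start (Q' κ) : ℕ) : ZMod (P.sitesPerDir j))).val ≤ len (Q' κ)) →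
      w Q x * g Q x = w Q' x * g Q' x)
    (V : GaugeField P j G) (b : PBond P j) :
    dist1 (GaugeField.gaugeAct (fun x => w (fun κ => owner (x κ)) x * g (fun κ => owner (x κ)) x) V b) ≤
      dist1 (GaugeField.gaugeAct (g (fun κ => owner (b.src κ))) V b) +
        dist1 (w (fun κ => owner (b.src κ)) b.src * (w (fun κ => owner (b.src κ)) b.tgt)⁻¹) := by
  set Q : Fin P.d → Fin M := fun κ => owner (b.src κ) with hQ
  -- read the target in the block `Q` (consistency between the target's owner block and `Q`)
  have htgt : w (fun κ => owner (b.tgt κ)) b.tgt * g (fun κ => owner (b.tgt κ)) b.tgt = w Q b.tgt * g Q b.tgt :=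
    hcons _ _ _ (fun κ => owner_mem_closedBlock len start owner hown b.tgt κ)
      (fun κ => tgt_mem_closedBlock len start owner hown hlen b κ)
  have e : GaugeField.gaugeAct (fun x => w (fun κ => owner (x κ)) x * g (fun κ => owner (x κ)) x) V b =
      (w Q b.src * (w Q b.tgt)⁻¹) * ((w Q b.tgt) * GaugeField.gaugeAct (g Q) V b * (w Q b.tgt)⁻¹) := by
    simp only [GaugeField.gaugeAct]
    rw [htgt, ← hQ]
    group
  rw [e]
  calc dist1 ((w Q b.src * (w Q b.tgt)⁻¹) * ((w Q b.tgt) * GaugeField.gaugeAct (g Q) V b * (w Q b.tgt)⁻¹))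
      ≤ dist1 (w Q b.src * (w Q b.tgt)⁻¹) + dist1 ((w Q b.tgt) * GaugeField.gaugeAct (g Q) V b * (w Q b.tgt)⁻¹) := GaugeGroup.dist1_mul_le _ _
    _ = dist1 (w Q b.src * (w Q b.tgt)⁻¹) + dist1 (GaugeField.gaugeAct (g Q) V b) := by rw [GaugeGroup.dist1_conj]
    _ = _ := add_comm _ _

/-- ★★ **THE GLUE WITH LETTERS**: a local-gauge letter `δ` (every `g_Q` gauges the bonds of `Q̄` within `δ`) and a section-step letter `η′` (every `w_Q` moves by `≤ η′`
along the bonds of `Q̄`) give `dist1 ≤ δ + η′` for every bond of the glued gauge. [cite: Balaban1985RegularSpaces, Lemma 1 p.79, (1.29) p.81] -/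
theorem dist1_glue_le_of_bounds (len start : Fin M → ℕ) (owner : ZMod (P.sitesPerDir j) → Fin M)
    (hown : ∀ v : ZMod (P.sitesPerDir j), start (owner v) ≤ v.val ∧ v.val < start (owner v) + len (owner v))
    (hlen : ∀ i, len i < P.sitesPerDir j)
    (g w : (Fin P.d → Fin M) → Site P j → G)
    (hcons : ∀ (Q Q' : Fin P.d → Fin M) (x : Site P j),
      (∀ κ, (x κ - ((start (Q κ) : ℕ) : ZMod (P.sitesPerDir j))).val ≤ len (Q κ)) →
      (∀ κ, (x κ - ((start (Q' κ) : ℕ) : ZMod (P.sitesPerDir j))).val ≤ len (Q' κ)) →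
      w Q x * g Q x = w Q' x * g Q' x)
    (V : GaugeField P j G) {δ η' : ℝ}
    (hloc : ∀ (Q : Fin P.d → Fin M) (b : PBond P j),
      (∀ κ, (b.src κ - ((start (Q κ) : ℕ) : ZMod (P.sitesPerDir j))).val ≤ len (Q κ)) →
      (∀ κ, (b.tgt κ - ((start (Q κ) : ℕ) : ZMod (P.sitesPerDir j))).val ≤ len (Q κ)) →
      dist1 (GaugeField.gaugeAct (g Q) V b) ≤ δ)
    (hstep : ∀ (Q : Fin P.d → Fin M) (b : PBond P j),
      (∀ κ, (b.src κ - ((start (Q κ) : ℕ) : ZMod (P.sitesPerDir j))).val ≤ len (Q κ)) →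
      (∀ κ, (b.tgt κ - ((start (Q κ) : ℕ) : ZMod (P.sitesPerDir j))).val ≤ len (Q κ)) →
      dist1 (w Q b.src * (w Q b.tgt)⁻¹) ≤ η')
    (b : PBond P j) :
    dist1 (GaugeField.gaugeAct (fun x => w (fun κ => owner (x κ)) x * g (fun κ => owner (x κ)) x) V b) ≤ δ + η' := by
  have h := dist1_glue_le len start owner hown hlen g w hcons V b
  have h1 := hloc (fun κ => owner (b.src κ)) b (fun κ => owner_mem_closedBlock len start owner hown b.src κ)
    (fun κ => tgt_mem_closedBlock len start owner hown hlen b κ)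
  have h2 := hstep (fun κ => owner (b.src κ)) b (fun κ => owner_mem_closedBlock len start owner hown b.src κ)
    (fun κ => tgt_mem_closedBlock len start owner hown hlen b κ)
  linarith

end Glue

/-! ## §3 The `SU(2)` arc reading -/

/-- ★★ **THE GLUED GAUGE IN ARC CURRENCY** (`SU(2)`): `‖logVec (su2Quat (glued bond))‖ ≤ (π∕2)·(δ + η′)` (✓`norm_logVec_le_pi_div_two_mul_dist1`) — the line LEAD's final
assembly `hBG_of_pieces` reads with `δ := (4ρ+6)θ` (✓`…ClosedBlockAxialGauge`) and `η′ := K∕ρ` ((G7)-lattice). [cite: Balaban1985RegularSpaces, Thm 2 p.83] -/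
theorem norm_logVec_glue_le_of_bounds (len start : Fin M → ℕ) (owner : ZMod (P.sitesPerDir j) → Fin M)
    (hown : ∀ v : ZMod (P.sitesPerDir j), start (owner v) ≤ v.val ∧ v.val < start (owner v) + len (owner v))
    (hlen : ∀ i, len i < P.sitesPerDir j)
    (g w : (Fin P.d → Fin M) → Site P j → SU2)
    (hcons : ∀ (Q Q' : Fin P.d → Fin M) (x : Site P j),
      (∀ κ, (x κ - ((start (Q κ) : ℕ) : ZMod (P.sitesPerDir j))).val ≤ len (Q κ)) →
      (∀ κ, (x κ - ((start (Q' κ) : ℕ) : ZMod (P.sitesPerDir j))).val ≤ len (Q' κ)) →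
      w Q x * g Q x = w Q' x * g Q' x)
    (V : GaugeField P j SU2) {δ η' : ℝ}
    (hloc : ∀ (Q : Fin P.d → Fin M) (b : PBond P j),
      (∀ κ, (b.src κ - ((start (Q κ) : ℕ) : ZMod (P.sitesPerDir j))).val ≤ len (Q κ)) →
      (∀ κ, (b.tgt κ - ((start (Q κ) : ℕ) : ZMod (P.sitesPerDir j))).val ≤ len (Q κ)) →
      dist1 (GaugeField.gaugeAct (g Q) V b) ≤ δ)
    (hstep : ∀ (Q : Fin P.d → Fin M) (b : PBond P j),
      (∀ κ, (b.src κ - ((start (Q κ) : ℕ) : ZMod (P.sitesPerDir j))).val ≤ len (Q κ)) →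
      (∀ κ, (b.tgt κ - ((start (Q κ) : ℕ) : ZMod (P.sitesPerDir j))).val ≤ len (Q κ)) →
      dist1 (w Q b.src * (w Q b.tgt)⁻¹) ≤ η')
    (b : PBond P j) :
    ‖logVec (su2Quat (GaugeField.gaugeAct (fun x => w (fun κ => owner (x κ)) x * g (fun κ => owner (x κ)) x) V b))‖ ≤ π / 2 * (δ + η') := by
  have h := dist1_glue_le_of_bounds len start owner hown hlen g w hcons V hloc hstep b
  have harc := norm_logVec_le_pi_div_two_mul_dist1 (GaugeField.gaugeAct (fun x => w (fun κ => owner (x κ)) x * g (fun κ => owner (x κ)) x) V b)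
  have hπ : 0 ≤ π / 2 := by positivity
  exact harc.trans (mul_le_mul_of_nonneg_left h hπ)

end Summit.QuantumFields.YangMills.Theorems.FluctuationComparisonRegPrIntLS2BetaSqrtGaugeGlue

end
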